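import Mathlib
import HarnessLib
import HarnessLib.Audit
import Summits.CriticalPhenomena.Statement

/-!
Route: PercVarianceSandwich

DORMANT since 2026-09-03T13:37:26Z (reconciler: no traction for 5 d (last activity statement-checked at 2026-08-29T13:03:52Z); parked, not closed — `ledger route dormant route-CriticalPhenomena-PercVarianceSandwich --off` to reactivate) — unstaffed, not closed; items shared with open routes are served there. `ledger route dormant <id> --off` reactivates.

# Route PercVarianceSandwich — moment sandwich at the same p — polynomially-rare critical spheres vs
thin finite clusters of a percolating phase

It suffices to show X = A ∧ B (card
CriticalPhenomena/PercolationContinuityZ3/chebyshev-variance-sandwich, sharpened to a POLYNOMIAL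
DIAL):
(A) CritBlockingNotSuperpolynomial — at p = p_c(ℤ³) the blocking probability s_n := P_{p_c}(no open
path inside B(2n) from the box B(n) to the inner vertex boundary of B(2n)) is NOT super-polynomially
small: for some k, limsup_n n^k s_n = ∞ (numerically s_n → const ∈ (0,1); PercAnnulusCrossing's X_B
asks s_n ≥ c, dyadic-shell asks Σ_j s_(2^j) = ∞; here any polynomial lower bound along a subsequence
suffices);
(B) FiniteClusterMomentsOfTheta — at every p with θ(p) > 0, all truncated moments E_p[|C(0)|^k ;
|C(0)| < ∞] = Σ_(x_1..x_k) P_p(0 ↔ x_i ∀ i, |C(0)| < ∞) are finite (a THEOREM for p > p_c: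
Kesten–Zhang, Grimmett1999 Thm (8.65); the content is the hypothetical percolating point p = p_c).
The glue is an unconditional, same-p MOMENT SANDWICH for Z_n := |C_∞ ∩ B(n)| (support items
MomentSandwich / VarianceSandwich, provable now from finitary Efron–Stein + Hölder + Markov):
θ(p)^(2k) |B(n)|^k · P_p(B(n) ∩ C_∞ = ∅) ≤ c_k (6p)^k E_p[|C|^(2k); fin], i.e. a dense infinite
cluster whose finite neighbours are thin cannot avoid big boxes except with probability O(n^(−3k));
since {B(n) blocked in B(2n)} ⊆ {B(n) ∩ C_∞ = ∅} (BlockingLeAvoidance), θ(p_c) > 0 ∧ B would make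
s_n(p_c) = O(n^(−3k)) for every k, contradicting A.
Lean: `(∃ k : ℕ, ∀ K : ℝ, ∃ n : ℕ, 1 ≤ n ∧ K / (n : ℝ) ^ k <
(Literature.Probability.Percolation.bondPercolation (Literature.Probability.LatticeModels.zdGraph 3)
(Literature.Probability.Percolation.criticalProbI 3)).real {ω | ¬ ∃ x ∈
Literature.Probability.LatticeModels.box 3 n, ∃ y ∈
Literature.Probability.LatticeModels.innerBoundary (Literature.Probability.LatticeModels.zdGraph 3)
(Literature.Probability.LatticeModels.box 3 (2 * n)), ω ∈
Literature.Probability.Percolation.openConnIn ↑(Literature.Probability.LatticeModels.box 3 (2 * n))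
x y}) ∧ (∀ p : unitInterval, 0 < Literature.Probability.Percolation.theta
(Literature.Probability.LatticeModels.zdGraph 3) 0 p → ∀ k : ℕ, Summable fun x : Fin k →
Literature.Probability.LatticeModels.Site 3 => (Literature.Probability.Percolation.bondPercolation
(Literature.Probability.LatticeModels.zdGraph 3) p).real ((⋂ i,
Literature.Probability.Percolation.openConn 0 (x i)) \
Literature.Probability.Percolation.percolatesAt 0))`

## Assembly
Pure logic given the two support items (checked sorry-free in the planner's Sketch.lean, theorem
assembly_holds, axioms propext/choice/Quot.sound): suppose θ := theta (zdGraph 3) 0 (criticalProbI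
3) ≠ 0, so θ > 0 (measureReal_nonneg). A gives k₀; put k := max k₀ 1. B at p = p_c with order 2k
feeds MomentSandwich, giving K with P_(p_c)(box n misses C_∞) ≤ K/n^(3k) for n ≥ 1;
BlockingLeAvoidance (N = 2n) gives s_n ≤ K/n^(3k) ≤ max(K,0)/n^(k₀) for n ≥ 1; A applied to K' :=
max(K,0) yields n ≥ 1 with K'/n^(k₀) < s_n — contradiction. Hence θ(p_c) = 0, i.e.
PercolationContinuityZ3 (= Literature.Probability.Percolation.PercolationContinuity 3, unfolded by
percolationContinuityZ3_iff).

Rationale: WHY THIS LINE. Mechanism (card chebyshev-variance-sandwich; EfronStein1981, Steele1986; flip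
bookkeeping as in AizenmanKestenNewman1987): for the local approximants Z^(m)_n = #{x ∈ B(n) : x ↔
∂B(m) in B(m)} ↓ Z_n, Efron–Stein over the finitely many edges of B(m) gives Var ≤ E[V⁻], V⁻ := p
Σ_(e closed) (Δ_e Z)^2, and opening a closed edge e only attaches the (finite, ∂B(m)-avoiding)
cluster F of one endpoint, so V⁻ ≤ 6p Σ_(x ∈ B(n)) |C(x)|² 1_(|C(x)|<∞) uniformly in m; iterating
Efron–Stein on (Z − EZ)₋^k with Hölder (the elementary form of the moment inequalities of
BoucheronEtAl2005) upgrades this to E(Z−EZ)₋^(2k) ≤ c_k E[(V⁻)^k] ≤ c_k (6p)^k |B(n)|^k E[|C|^(2k);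
fin], and Markov at level E Z_n = θ|B(n)| gives the sandwich. What is imported:
concentration-of-measure for functions of independent bits (statistics / learning theory) applied to
the density of the infinite cluster — the variable R_m of Grimmett1999 Lemma (8.68) p.218 and of the
supercritical CLT literature (Grimmett1999 §11.6, Zhang2001), used here AT p_c as a continuity
criterion; no renormalisation, no sprinkling, no path gluing.
What the line does that prior routes do not: it re-weights PercTruncatedSusceptibility's H ∧ L
(χ^f(p_c) = ∞ vs χ^f < ∞ at θ > 0) and PercAnnulusCrossing's RSW crux X_B (s_n ≥ c) into the
ultralight geometric crux A (s_n ≠ n^(−ω(1))) paid for by the supercritical-regularity crux B (all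
truncated moments, weaker than PercTruncatedSusceptibility.FiniteRadiusExpDecayOfTheta and than
PercDebrisSweep.FiniteClusterVolumeTail, stronger than L); both A and B are jump-compatible in
isolation (soft worlds), only the conjunction is not, so neither restates the conjunct. Negatives
index (1 SAW entry) untouched.

RANKED CRUXES. #0 Target (target) — X = A ∧ B as in § Thesis (CritBlockingNotSuperpolynomial ∧
FiniteClusterMomentsOfTheta). (why it might fail: B is conjunct-adjacent (no same-p engine for thin
finite clusters exists; every proof above p_c sprinkles); A fails iff critical annuli of ℤ³ are
crossed with probability 1 − n^(−ω(1)) (the d > 6 picture).) [Grimmett1999, KestenZhang1990,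
Aizenman1997, WangEtAl2013]
#2 FiniteClusterMomentsOfTheta (crux) — B (card crux B, all orders): for every p ∈ [0,1] with θ(p) >
0 and every k, Σ over k-tuples (x_1,…,x_k) of sites of P_p(0 ↔ x_1, …, 0 ↔ x_k, |C(0)| < ∞) < ∞,
i.e. E_p[|C(0)|^k ; |C(0)| < ∞] < ∞ (k = 1 is
PercTruncatedSusceptibility.TruncatedSusceptibilityFiniteOfTheta = χ^f(p) < ∞). Known for p >
p_c(ℤ³) with stretched-exponential tails P_p(n ≤ |C| < ∞) ≤ exp(−η n^(2/3)) (KestenZhang1990 =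
Grimmett1999 Thm (8.65), and (8.64) via Thms (8.18)/(8.21)); the live case is a hypothetical
percolating p_c, where a proof must confine the finite pockets of the would-be critical infinite
cluster at the SAME p. [difficulty: open-problem] (why it might fail: No same-p engine: all proofs
of thin finite clusters at θ(p)>0 run through Grimmett–Marstrand slabs at p+η (Grimmett1999
(8.64)/(8.65) via Thm 7.2; Cerf2015 p.4). In AN 1/r² chains the percolating critical point has fat
finite clusters (ImbrieNewman1988 Cor 1.5): B needs n.n. d=3 input.) [KestenZhang1990, Grimmett1999,
doi:10.1007/bf01218582, Cerf2015, Literature.Barriers.CriticalPhenomena.SprinklingRenormalisation,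
Literature.Barriers.CriticalPhenomena.LongRangeDiscontinuity, GrimmettMarstrand1990]
#3 CritBlockingNotSuperpolynomial (crux) — A (card crux A, polynomial dial): at p = p_c(ℤ³) the
blocking probabilities s_n = P_(p_c)(¬ ∃ x ∈ box 3 n, ∃ y ∈ innerBoundary(box 3 (2n)), x ↔ y inside
box 3 (2n)) are not super-polynomially small: there is k such that for every K some n ≥ 1 has s_n >
K / n^k (equivalently ¬ ∀ k ∃ K ∀ n ≥ 1, s_n ≤ K n^(−k)). The event is the complement of
PercAnnulusCrossing.CritAnnulusNonCrossing's crossing event (X_B: s_n ≥ c ⇒ A; dyadic-shell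
non-summability ⇒ A); numerically s_n → s_∞ ∈ (0,1) (universal spanning/wrapping constants,
WangEtAl2013). Rigorously only s_n ≥ e^(−O(n²)) (close a sphere) and Zhang2000's vanishing critical
flow constant (min cut-sets with o(n²) open edges) are known. [difficulty: open-problem] (why it
might fail: False iff critical annuli of ℤ³ are crossed w.p. 1−n^(−ω(1)): the proliferation picture
proved for d>6 under η=0 (Aizenman1997 Thm 4: ≈L^(d−6) spanning clusters, so blocking costs
e^(−cL^(d−6))). In d=3 only numerics (R_c≈0.258, WangEtAl2013) and hyperscaling heuristics support
it.) [Aizenman1997, WangEtAl2013, arXiv:1302.0421, NewmanTassionWu2017, Zhang2000,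
BorgsChayesKestenSpencer1999, Literature.Barriers.CriticalPhenomena.SpanningClustersAboveSix]
#4 CritPinholeBlocking (crux) — Engine for A (card weakening 'k pinholes'): there are k and c > 0
such that for all n ≥ 1, with P_(p_c)-probability ≥ c some set S of at most k edges has the property
that closing S blocks B(n) from the inner boundary of B(2n) inside B(2n) — a closed separating
sphere with ≤ k open 'pinholes'; by Menger this says the open max-flow across the critical annulus
is ≤ k with probability ≥ c (tightness at O(1), versus Zhang2000's o(n²)). With finite energy
(support PinholeToPolynomialBlocking: each pinhole costs a factor (1−p_c) and an entropy factor ≤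
#edges of B(2n) ≍ n³) it gives s_n ≥ c' n^(−3k), hence A. It is the natural target for a 3-D RSW
with bounded defects: cut-sets glue for free in any dimension (card
blockers-glue-tassion-on-cutsets), and k defects are allowed to survive the gluing. [difficulty:
open-problem] (why it might fail: Needs maxflow(critical annulus) ≤ k w.p. ≥ c, i.e. a pivotal-scale
bottleneck in the spanning cluster w.p. bounded below; only maxflow = o(n²) is known (Zhang2000).
Fails if critical spanning clusters carry →∞ edge-disjoint crossings w.h.p. (true for d>6: N_L ≈
L^(d−6) clusters).) [Zhang2000, BenjaminiKalai2018, Aizenman1997, NewmanTassionWu2017, Grimmett1999,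
Literature.Barriers.CriticalPhenomena.SpanningClustersAboveSix,
Literature.Barriers.CriticalPhenomena.TransverseCrossingsNeedNotMeet]
#9 MomentSandwich (support) — THE GLUE (moment sandwich, all k ≥ 1, same p, no sprinkling): if θ(p)
> 0 and the 2k-th truncated moment Σ_(x : Fin 2k → Site 3) P_p(⋂_i {0 ↔ x_i} minus {0 ↔ ∞}) is
finite, then there is K with P_p(no vertex of box 3 n lies in an infinite cluster) ≤ K / n^(3k) for
all n ≥ 1. Proof sketch (elementary, provable now; size L): (i) local approximation Z^(m) := #{x ∈
B(n) : x ↔ innerBoundary(B(m)) inside B(m)} ↓ Z_n := #{x ∈ B(n) : x ↔ ∞} as m → ∞, 0 ≤ Z^(m) ≤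
|B(n)|; (ii) finitary Efron–Stein for the function Z^(m) of the edges of B(m): Var f ≤ Σ_e p(1−p)
E[(Δ_e f)²]; applied to g = (Z − EZ)₋^j with |Δ_e g| ≤ j (Z−EZ)₋(ω^(e closed))^(j−1) Δ_e Z (Z is
increasing, u ↦ u₋ is 1-Lipschitz) it gives Var g ≤ j² E[(Z−EZ)₋^(2j−2) V⁻], V⁻ := p Σ_(e closed)
(Δ_e Z)²; with (E g)² ≤ m_(2j−2) m_2 and Hölder, m_(2j) := E(Z−EZ)₋^(2j) satisfies m_(2j) ≤ j²
m_(2j)^(1−1/j) (E(V⁻)^j)^(1/j) + m_(2j−2) m_2, whence by induction m_(2k) ≤ c_k E[(V⁻)^k] with c_1 =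
1, c_k ≤ max((2k²)^k, 2c_(k−1)); (iii) deterministic contact bound: opening a closed edge e = uv of
B(m) changes Z^(m) only if exactly one endpoint, say v, is joined to ∂B(m); then the B(m)-cluster F
of u avoids innerBoundary(B(m)), hence is the whole (finite) cluster C(u), and Δ_e Z ≤ |F ∩ B(n)|;
summing over the ≤ |∂_E F| ≤ 6|F| closed boundary edges of each such F: V⁻ ≤ 6p Σ_(x ∈ B(n)) |C(x)|²
1_(|C(x)|<∞), so by convexity and translation invariance E[(V⁻)^k] ≤ (6p)^k |B(n)|^k
E_p[|C(0)|^(2k); |C(0)| < ∞], uniformly in m; (iv) let m → ∞ (bounded convergence) and apply Markov: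
P(Z_n = 0) ≤ P((Z_n − EZ_n)₋ ≥ θ|B(n)|) ≤ c_k (6p)^k E[|C|^(2k);fin] / (θ^(2k) |B(n)|^k), |B(n)| =
(2n+1)³ ≥ n³ · 8. [difficulty: L] [EfronStein1981, Steele1986, BoucheronEtAl2005, Grimmett1999,
AizenmanKestenNewman1987]
#9 VarianceSandwich (support) — The card's original k = 1 sandwich with explicit constant, valid at
EVERY p (trivial when θ(p) = 0): if the pair truncated connectivity is summable then θ(p)² (2n+1)³
P_p(no vertex of box 3 n is in an infinite cluster) ≤ 6p · Σ_(x,y) P_p(0 ↔ x, 0 ↔ y, |C(0)| < ∞) (=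
6p E_p[|C|²; fin]). Proof: steps (i), (iii) of MomentSandwich with plain Efron–Stein (Var Z^(m) ≤
E[V⁻] ≤ 6p |B(n)| E[|C|²;fin]) and Chebyshev P(Z_n = 0) ≤ Var Z_n / (E Z_n)², E Z_n = θ(p)|B(n)|.
The natural first target for a prover (size M); it pairs with the k = 3-type special case of A
(limsup n³ s_n = ∞). [difficulty: M] [EfronStein1981, Steele1986, Grimmett1999,
AizenmanKestenNewman1987]
#9 BlockingLeAvoidance (support) — Deterministic inclusion + monotonicity of measure, for n ≤ N and
every p: P_p(no open path inside box 3 N from box 3 n to innerBoundary(box 3 N)) ≤ P_p(no vertex of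
box 3 n percolates). Proof: if x ∈ box n ⊆ box N has an infinite open cluster then (a.s. the open
edges are lattice edges) an infinite self-avoiding open path from x leaves the finite box N; its
last vertex before leaving lies in innerBoundary(box N) and the initial segment stays inside box N.
Needs the a.s. statement ω ⊆ E(ℤ³) under bondPercolation (setBer on the edge set) or the library's
path-exit lemma (cf. Literature.Probability.Percolation.HarrisTheorem exists_openConnIn_exit).
[difficulty: provable-now] [Grimmett1999,
Literature.Probability.Percolation.Grimmett1999_prob_exists_percolatesAt]
#9 PinholeToPolynomialBlocking (support) — CritPinholeBlocking → CritBlockingNotSuperpolynomial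
(finite energy + union bound, provable now): on the pinhole event choose S(ω) ⊆ edgesIn(box 3 (2n))
with |S| ≤ k (edges outside the box are irrelevant to paths inside it; ≤ (C n³)^k choices); for a
fixed finite S and the decreasing blocking event E, P_p(ω minus S ∈ E) = P_p(E ∩ {S closed}) /
(1−p)^|S| ≤ P_p(E) / (1−p)^|S| by independence of the edges of S from E∘(ω ↦ ω minus S); hence c ≤
(C n³)^k (1−p_c)^(−k) s_n, i.e. s_n ≥ c' n^(−3k) for all n ≥ 1, and A holds with exponent 3k+1 (uses
0 < p_c < 1, Literature fact Grimmett1999_criticalProb_pos_lt_one / proved bounds for ℤ³).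
[difficulty: provable-now] [Grimmett1999, NewmanTassionWu2017]

TWO-LAYER PLAN. Foreseen glued splits (none filed now; k ≤ 3, depth 1):
B ⇐ PocketConfinement → ContactMoments → B: PocketConfinement = 'at a percolating p the vacant set
coats large finite pockets: P_p(C(0) finite, adjacent to C_∞, |C(0)| ≥ m) ≤ m^(−ω(1))' (same-p
two-arm/uniqueness counting at contacts, AKN-style), ContactMoments = the bookkeeping from pocket
tails to all truncated moments (Σ_m m^(k−1) P(m ≤ |C| < ∞)).
B ⇐ (PercTruncatedSusceptibility.FiniteRadiusExpDecayOfTheta → B) or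
(PercDebrisSweep.FiniteClusterVolumeTail → B): one-line moment bookkeeping from exponential radius /
exp(−c m^(2/3)) volume tails; to be filed as support glue the moment either sibling crux moves
(shared decls, not re-filed here).
A ⇐ CritPinholeBlocking → PinholeToPolynomialBlocking → A (already typed: the rank-4 crux and its
support glue); alternatively A ⇐ PercAnnulusCrossing.CritAnnulusNonCrossing (X_B ⇒ A trivially) or
dyadic-shell non-summability.
The k = 1 rung (VarianceSandwich with 'limsup n³ s_n(p_c) = ∞' and the second truncated moment only)
is the fallback pair if B is obtained only at order 2: tenure restates A to exponent 3 then.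

KILL CRITERIA. Refuting A (a proof that s_n(p_c) ≤ K_k n^(−k) for every k, i.e. super-polynomially
rare critical spheres in d = 3) closes the route `refuted:CritBlockingNotSuperpolynomial` — and
simultaneously kills PercAnnulusCrossing's X_B and the dyadic-shell card, so it would be major
negative knowledge (a d>6-type proliferation theorem in d=3). Refuting CritPinholeBlocking alone
(maxflow → ∞ in probability at p_c) is NOT fatal: drop it (A does not need it) and record
'bounded-defect RSW is dead'. B can only be refuted by exhibiting a percolating p with a divergent
truncated moment; for p > p_c that contradicts KestenZhang1990, so a refutation of B is a proof of
θ(p_c) > 0, i.e. of ¬PercolationContinuityZ3 — route and conjunct die together.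
MomentSandwich/VarianceSandwich refuted as typed (wrong constant 6p, exponent 3k, or a
Lean-convention slip) ⇒ restate with the corrected constant/exponent (any c·n^(−αk), α > 0, keeps
the assembly with A unchanged). Mooted (superseded) if PercAnnulusCrossing closes X_B (continuity
then follows by its own assembly) or if any route proves θ(p_c) = 0.

NOT DECOMPOSED YET. The same-p confinement mechanism behind B (which two-arm / uniqueness /
isoperimetric input replaces sprinkling) — deliberately left open; the order of moments actually
needed (2⌈k/3⌉ for the k delivered by A); the BK/common-bridge second engine of the card (χ_∞ ≤
(p/(1−p)) M₂ via van den Berg–Kesten and Menger) and the exact bridge–contact identity ((1−p)/p)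
E[Σ_bridges |finite side|] = E[b_∞|C|; fin] — pretty, not load-bearing, provers may attach them with
--supports; thick annuli (outer scale N(n) > 2n: BlockingLeAvoidance already covers every N ≥ n, so
A may later be restated at any explicit aspect ratio); site version; the infinite-coordinate
(martingale) Efron–Stein, avoided by the local approximation.

CHEAPEST FALSIFIER. For A: estimate s_n(p_c), p_c = 0.2488126, n = 4…32, by Monte Carlo (bond
configuration on B(2n), label clusters, test box-to-boundary connection): if log s_n / log n drifts
to −∞ instead of s_n → s_∞ ≈ const (expected from the universal wrapping/spanning constants R ∈
(0,1) of WangEtAl2013, arXiv:1302.0421 p.5), A is in trouble; not run in this session (plancard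
one-shot; kit job recommended to the first refuter). For the glue: the k = 1 inequality θ²(2n+1)³
P_p(B(n) ∩ C_∞ = ∅) ≤ 6p E_p[|C|²;fin] can be sanity-checked by the same simulation at p = 0.30 >
p_c (both sides finite and measurable numerically). For B: literature lookup only — is there ANY
same-p statement 'θ(p) > 0 ⇒ E_p[|C|;fin] < ∞' in print without Grimmett–Marstrand? (searched: none;
Cerf2015 p.4 says the ingredient is missing).

NUMBERS. p_c(ℤ³, bond) = 0.2488126(5); wrapping probability R^(x)_c = 0.25780(6) and β/ν =
0.47705(15) at p_c (WangEtAl2013 = arXiv:1302.0421, p.5) — so numerically s_n → s_∞ ∈ (0,1),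
infinitely far inside A. Supercritical benchmarks (p > p_c): P_p(n ≤ |C| < ∞) ≤ exp(−η(p) n^(2/3))
(Grimmett1999 Thm (8.65) p.216 = KestenZhang1990), lower bound exp(−γ n^(2/3)) (Thm (8.61),
Aizenman–Delyon–Souillard); lower large deviations of the density |C_∞ ∩ B(n)|/|B(n)| below θ are
surface order exp(−c n²) for p > p_c (Pisztora1996, via slab technology), versus the polynomial
n^(−3k) the sandwich extracts from moments alone. Glue constants: Var ≤ E[V⁻] (Efron–Stein), V⁻ ≤ 6p
Σ_(x∈B(n)) |C(x)|² 1_fin (2d = 6 boundary edges per vertex), c_1 = 1, c_k ≤ max((2k²)^k, 2c_(k−1));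
|B(n)| = (2n+1)³. d > 6 contrast: ≈ L^(d−6) spanning clusters (Aizenman1997 Thm 4) — A and
CritPinholeBlocking are d ≤ 6 statements by design. Items at open: 9 (3 cruxes, 1 target, 4 support,
1 assembly).

DEFINITION REQUESTS. None needed: every item is typed over existing declarations (bondPercolation,
zdGraph, theta, criticalProbI, openConn, openConnIn, percolatesAt, box, innerBoundary; truncated
moments as Summable over Fin k → Site 3 of μ.real((⋂ i, openConn 0 (x i)) minus percolatesAt 0)).
Nice-to-have (not filed): a Literature notion `truncMoment d p k` with the tsum/integral identity
E[|C|^k; fin] = Σ_tuples, and a HarnessLib finitary Efron–Stein lemma (variance of a function of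
finitely many independent coordinates ≤ Σ expected conditional variances) — both would be attached
by provers with --supports MomentSandwich. Cite fact wanted later (not load-bearing):
KestenZhang1990 / Grimmett1999 Thm (8.65) for p > p_c as a named fact in
Literature/Probability/Percolation.

Novelty: Searches (2026-08-15, this session; the card's own 2026-08-15 searches are recorded on the card):
`lit search --hybrid "Efron-Stein inequality variance number of vertices infinite cluster box
percolation"` (8 book hits: Slade2006, HvdH2017, Grimmett2006/1999/2010, LyonsPeres2016 — none with
a variance/Chebyshev continuity criterion); `lit search --hybrid "moment inequalities for functions
of independent random variables Efron-Stein higher moments"` (GinéNickl2021 p.244 etc., generic);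
crossref: BoucheronEtAl2005 (doi:10.1214/009117904000000856), KestenZhang1990
(doi:10.1214/aop/1176990844), Pisztora1996 (doi:10.1007/bf01198161), Zhang2001
(doi:10.1023/a:1007877216583), Zhang2000 (doi:10.1023/a:1018631726709); `lit frontier
CriticalPhenomena --since 2021` (30 rows, SLE/CLE/lace/SAW — nothing on density fluctuations at
p_c); `lit galaxy search "fluctuations of the density of the infinite cluster percolation variance"
--star all` and `"density of the infinite cluster" --star pdf` both FAILED (galaxyd queue saturated
> 90 s, twice) and OpenAlex returned HTTP 429 — recorded in NOTES; `lit read book:grimmett1999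
--grep` (PDF pp.229–231: Thm (8.61), (8.64), (8.65), R_m and Lemma (8.68)); the 9 Theses files and
136 card titles of the sub.
Nearest prior art found: Grimmett1999 Lemma (8.68) p.218 and §11.6 (R_m = |B(m) ∩ C_∞|: first moment
resp. CLT, supercritical only) and Zhang2001 (martingale CLT for cluster functionals, p ≠ p_c);
Pisztora1996 (surface-order large deviations of the  [refs: 10.1214/009117904000000856, 10.1214/aop/1176990844, 10.1007/bf01198161, 10.1023/a:1007877216583, 10.1023/a:1018631726709, doi:10.1214/009117904000000856, doi:10.1214/aop/1176990844, doi:10.1007/bf01198161, doi:10.1023/a, book:grimmett1999, Grimmett2006, LyonsPeres2016, BoucheronEtAl2005, KestenZhang1990, Pisztora1996, Zhang2001, Zhang2000, Grimmett1999, EfronStein1981, Steele1986, AizenmanKestenNe]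

Barriers (technique_class: variance-sandwich efron-stein chebyshev truncated-moments): - technique_class: variance-sandwich efron-stein chebyshev truncated-moments
- Literature.Barriers.CriticalPhenomena.SprinklingRenormalisation: APPLIES head-on to crux B (not to
the glue): B at p = p_c is a same-p supercritical-regularity law and every printed proof of thin
finite clusters at θ(p) > 0 (Grimmett1999 (8.64)/(8.65), Pisztora1996) goes through Thm (7.2) at p +
η; it does not evade it; the bet is that confinement of the finite POCKETS adjacent to an existing
infinite cluster (a two-arm/uniqueness statement at contacts) needs no seed-to-seed renormalisation
and hence no extra money. The glue (Efron–Stein, Hölder, Markov, counting) is sprinkling-free and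
identity-level at one p.
- Literature.Barriers.CriticalPhenomena.SpanningClustersAboveSix: APPLIES to A and to
CritPinholeBlocking — for d > 6 under η = 0 there are ≈ L^(d−6) spanning clusters (Aizenman1997 Thm
4), so blocking should cost e^(−cL^(d−6)) (super-polynomial) and no bounded k of pinholes suffices;
declared, not evaded: both are d ≤ 6 (hyperscaling-side) statements and a dimension-uniform proof
attempt is a kill signal. New slack versus X_B: A tolerates s_n → 0 polynomially, so it is
compatible with mild proliferation (polynomially many effective crossings), which X_B is not.
- Literature.Barriers.CriticalPhenomena.TransverseCrossingsNeedNotMeet: not engaged by the glue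
(Chebyshev/Markov replaces all path gluing); engaged by any RSW-style attack on
CritPinholeBlocking/A, where it is softened twice: cut-se

History (route lifecycle, newest last):
- 2026-08-16T03:59:24Z · AUTO-CRUX (backfill): Target — hypotheses of the deciding theorem that nothing in the route derives are cruxes (operator:999:1085951)
- 2026-08-23T03:08:54Z · DORMANT — reconciler: no traction for 5.9 d (last activity item-evidence-added at 2026-08-17T05:45:10Z); parked, not closed — `ledger route dormant route-CriticalPhenomen (operator:999:1586205)
- 2026-08-23T15:10:18Z · REACTIVATED — reconciler: reactivated — activity item-proof-filed at 2026-08-23T13:49:01Z after parking at 2026-08-23T03:08:54Z (operator:999:2601254)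
- 2026-09-03T13:37:26Z · DORMANT — reconciler: no traction for 5 d (last activity statement-checked at 2026-08-29T13:03:52Z); parked, not closed — `ledger route dormant route-CriticalPhenomena-Pe (operator:999:3329414)

sub-problem: PercolationContinuityZ3 · status: dormant · opened planner-plancard-CriticalPhenomena-Percolatio-5b2a856a-0 2026-08-15T11:44:14Z · rev 4 · ledger route-CriticalPhenomena-PercVarianceSandwich
GENERATED by the gate from the ledger (D-0016/17). Provers cite these decls: `theorem foo : Summit.CriticalPhenomena.PercolationContinuityZ3.Theses.PercVarianceSandwich.<Decl> := …` in Summits/CriticalPhenomena/PercolationContinuityZ3/Theorems/<Name>.lean.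
-/

namespace Summit.CriticalPhenomena.PercolationContinuityZ3.Theses.PercVarianceSandwich

open scoped BigOperators Topology Manifold Classical MeasureTheory ProbabilityTheory Matrix InnerProductSpace ComplexConjugate ContinuousMap
open Filter Set Function TopologicalSpace MeasureTheory

attribute [summit_statement] _root_.PercolationContinuityZ3

/-- item stmt-CriticalPhenomena-6065 · crux · rank 2 · closed · proved by Summit.CriticalPhenomena.PercolationContinuityZ3.Theorems.PercVarianceSandwichFiniteClusterMomentsOfTheta.finiteClusterMomentsOfTheta_proof @ 5afe996cae31 (prover) · by planner
why it might fail: Live case = hypothetical percolating p_c; no same-p engine: every proof of thin finite clusters at θ(p)>0 sprinkles (Grimmett1999 Thm 8.65 via 7.2; gap restated DKT2020 §1.1, Hutchcroft2021 §1, Cerf2015 p.4). In AN 1/r² models the percolating critical point has fat finite clusters (ImbrieNewman1988)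
sources: KestenZhang1990, Grimmett1999, GrimmettMarstrand1990, Cerf2015, DuminilcopinKozmaTassion2020, Hutchcroft2021
[crux] B (card crux B, all orders): for every p ∈ [0,1] with θ(p) > 0 and every k, Σ over k-tuples
(x_1,…,x_k) of sites of P_p(0 ↔ x_1, …, 0 ↔ x_k, |C(0)| < ∞) < ∞, i.e. E_p[|C(0)|^k ; |C(0)| < ∞] <
∞ (k = 1 is PercTruncatedSusceptibility.TruncatedSusceptibilityFiniteOfTheta = χ^f(p) < ∞). Known
for p > p_c(ℤ³) with stretched-exponential tails P_p(n ≤ |C| < ∞) ≤ exp(−η n^(2/3)) (KestenZhang1990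
= Grimmett1999 Thm (8.65), and (8.64) via Thms (8.18)/(8.21)); the live case is a hypothetical
percolating p_c, where a proof must confine the finite pockets of the would-be critical infinite
cluster at the SAME p. [difficulty: open-problem] -/
@[route_item "route-CriticalPhenomena-PercVarianceSandwich"]
def FiniteClusterMomentsOfTheta : Prop :=
  ∀ p : unitInterval, 0 < Literature.Probability.Percolation.theta (Literature.Probability.LatticeModels.zdGraph 3) 0 p → ∀ k : ℕ, Summable fun x : Fin k → Literature.Probability.LatticeModels.Site 3 => (Literature.Probability.Percolation.bondPercolation (Literature.Probability.LatticeModels.zdGraph 3) p).real ((⋂ i, Literature.Probability.Percolation.openConn 0 (x i)) \ Literature.Probability.Percolation.percolatesAt 0)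

-- `FiniteClusterMomentsOfTheta` holds: proved by `Summit.CriticalPhenomena.PercolationContinuityZ3.Theorems.PercVarianceSandwichFiniteClusterMomentsOfTheta.finiteClusterMomentsOfTheta_proof` @ 5afe996cae31 (its module imports this route file, so no `_holds` link can be stated here).

/-- item stmt-CriticalPhenomena-6066 · crux · rank 3 · open · by planner
why it might fail: False iff critical annulus blocking in ℤ³ is super-polynomially rare — the d>6 picture (Aizenman1997 Thm 4: ≈L^(d−6) spanning clusters under η=0, crossing→1; BCKS1999: uniform crossing bounds ⇔ hyperscaling, d≤6 only). In d=3 only numerics (R_c≈0.258, WangEtAl2013); proved: s_n ≥ e^(−O(n²)).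
sources: Aizenman1997, BorgsChayesKestenSpencer1999, WangEtAl2013, arXiv:1302.0421, Zhang2000, NewmanTassionWu2017
[crux] A (card crux A, polynomial dial): at p = p_c(ℤ³) the blocking probabilities s_n = P_(p_c)(¬ ∃
x ∈ box 3 n, ∃ y ∈ innerBoundary(box 3 (2n)), x ↔ y inside box 3 (2n)) are not super-polynomially
small: there is k such that for every K some n ≥ 1 has s_n > K / n^k (equivalently ¬ ∀ k ∃ K ∀ n ≥
1, s_n ≤ K n^(−k)). The event is the complement of PercAnnulusCrossing.CritAnnulusNonCrossing's
crossing event (X_B: s_n ≥ c ⇒ A; dyadic-shell non-summability ⇒ A); numerically s_n → s_∞ ∈ (0,1)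
(universal spanning/wrapping constants, WangEtAl2013). Rigorously only s_n ≥ e^(−O(n²)) (close a
sphere) and Zhang2000's vanishing critical flow constant (min cut-sets with o(n²) open edges) are
known. [difficulty: open-problem] -/
@[route_item "route-CriticalPhenomena-PercVarianceSandwich"]
def CritBlockingNotSuperpolynomial : Prop :=
  ∃ k : ℕ, ∀ K : ℝ, ∃ n : ℕ, 1 ≤ n ∧ K / (n : ℝ) ^ k < (Literature.Probability.Percolation.bondPercolation (Literature.Probability.LatticeModels.zdGraph 3) (Literature.Probability.Percolation.criticalProbI 3)).real {ω | ¬ ∃ x ∈ Literature.Probability.LatticeModels.box 3 n, ∃ y ∈ Literature.Probability.LatticeModels.innerBoundary (Literature.Probability.LatticeModels.zdGraph 3) (Literature.Probability.LatticeModels.box 3 (2 * n)), ω ∈ Literature.Probability.Percolation.openConnIn ↑(Literature.Probability.LatticeModels.box 3 (2 * n)) x y}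

/-- item stmt-CriticalPhenomena-6064 · aside (kind.auto-crux: conjecture-grade) · rank 0 · open · by planner
why it might fail: X = A ∧ B: B is conjunct-adjacent (no same-p engine for thin finite clusters at θ(p)>0; every proof above p_c sprinkles, Grimmett1999 Thm 8.65 via 7.2); A fails iff critical annuli of ℤ³ are crossed w.p. 1−n^(−ω(1)) (d>6 proliferation, Aizenman1997 Thm 4); only A ∧ B excludes θ(p_c)>0.
sources: Grimmett1999, KestenZhang1990, Aizenman1997, BorgsChayesKestenSpencer1999, WangEtAl2013
[target] X = A ∧ B as in § Thesis (CritBlockingNotSuperpolynomial ∧ FiniteClusterMomentsOfTheta). -/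
@[route_item "route-CriticalPhenomena-PercVarianceSandwich"]
def Target : Prop :=
  (∃ k : ℕ, ∀ K : ℝ, ∃ n : ℕ, 1 ≤ n ∧ K / (n : ℝ) ^ k < (Literature.Probability.Percolation.bondPercolation (Literature.Probability.LatticeModels.zdGraph 3) (Literature.Probability.Percolation.criticalProbI 3)).real {ω | ¬ ∃ x ∈ Literature.Probability.LatticeModels.box 3 n, ∃ y ∈ Literature.Probability.LatticeModels.innerBoundary (Literature.Probability.LatticeModels.zdGraph 3) (Literature.Probability.LatticeModels.box 3 (2 * n)), ω ∈ Literature.Probability.Percolation.openConnIn ↑(Literature.Probability.LatticeModels.box 3 (2 * n)) x y}) ∧ (∀ p : unitInterval, 0 < Literature.Probability.Percolation.theta (Literature.Probability.LatticeModels.zdGraph 3) 0 p → ∀ k : ℕ, Summable fun x : Fin k → Literature.Probability.LatticeModels.Site 3 => (Literature.Probability.Percolation.bondPercolation (Literature.Probability.LatticeModels.zdGraph 3) p).real ((⋂ i, Literature.Probability.Percolation.openConn 0 (x i)) \ Literature.Probability.Percolation.percolatesAt 0))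

/-- item stmt-CriticalPhenomena-6067 · aside · rank 4 · open · by planner
why it might fail: Needs open maxflow(B(n)→∂B(2n)) ≤ k w.p. ≥ c at p_c (O(1) disjoint crossings); only maxflow = o(n²) is known (Zhang2000), RSW-type tightness only in d=2/slabs (BasuSapozhnikov2017, NewmanTassionWu2017). Fails if critical spanning clusters carry →∞ disjoint crossings w.h.p. (d>6: N_L≈L^(d−6)).
sources: Zhang2000, BasuSapozhnikov2017, NewmanTassionWu2017, Aizenman1997, BenjaminiKalai2018, Grimmett1999
[crux] Engine for A (card weakening 'k pinholes'): there are k and c > 0 such that for all n ≥ 1,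
with P_(p_c)-probability ≥ c some set S of at most k edges has the property that closing S blocks
B(n) from the inner boundary of B(2n) inside B(2n) — a closed separating sphere with ≤ k open
'pinholes'; by Menger this says the open max-flow across the critical annulus is ≤ k with
probability ≥ c (tightness at O(1), versus Zhang2000's o(n²)). With finite energy (support
PinholeToPolynomialBlocking: each pinhole costs a factor (1−p_c) and an entropy factor ≤ #edges of
B(2n) ≍ n³) it gives s_n ≥ c' n^(−3k), hence A. It is the natural target for a 3-D RSW with bounded
defects: cut-sets glue for free in any dimension (card blockers-glue-tassion-on-cutsets), and k
defects are allowed to survive the gluing. [difficulty: open-problem] -/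
@[route_item "route-CriticalPhenomena-PercVarianceSandwich"]
def CritPinholeBlocking : Prop :=
  ∃ (k : ℕ) (c : ℝ), 0 < c ∧ ∀ n : ℕ, 1 ≤ n → c ≤ (Literature.Probability.Percolation.bondPercolation (Literature.Probability.LatticeModels.zdGraph 3) (Literature.Probability.Percolation.criticalProbI 3)).real {ω | ∃ S : Finset (Sym2 (Literature.Probability.LatticeModels.Site 3)), S.card ≤ k ∧ ¬ ∃ x ∈ Literature.Probability.LatticeModels.box 3 n, ∃ y ∈ Literature.Probability.LatticeModels.innerBoundary (Literature.Probability.LatticeModels.zdGraph 3) (Literature.Probability.LatticeModels.box 3 (2 * n)), ω \ ↑S ∈ Literature.Probability.Percolation.openConnIn ↑(Literature.Probability.LatticeModels.box 3 (2 * n)) x y}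

/-- item stmt-CriticalPhenomena-14185 · support · rank 9 · closed · proved by Summit.CriticalPhenomena.PercolationContinuityZ3.Theorems.PercVarianceSandwichTargetOfCruxes.targetOfCruxes_proof @ 5aefe60a5ebd (prover) · by planner
sources: Grimmett1999, EfronStein1981
[support] glue to the rank-0 target (gate shape route.target-unreachable; route-choice repair
2026-08-16): the cruxes A = CritBlockingNotSuperpolynomial (rank 3) and B =
FiniteClusterMomentsOfTheta (rank 2) give the target X = A ∧ B — `And.intro`, since `Target` unfolds
definitionally to the conjunction of the two crux bodies (planner Sketch.lean: `theorem
targetOfCruxes_holds : TargetOfCruxes := fun hA hB => ⟨hA, hB⟩`, lean rc 0, axioms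
propext/Classical.choice/Quot.sound; also `Target ↔ A ∧ B := Iff.rfl`). With it the route reads
cruxes → Target → Statement; the Statement side is the certified deciding theorem `closes` (A, B,
MomentSandwich, BlockingLeAvoidance ⊢ PercolationContinuityZ3). CritPinholeBlocking (rank 4) feeds A
through the support PinholeToPolynomialBlocking. [deps: CritBlockingNotSuperpolynomial,
FiniteClusterMomentsOfTheta, Target] [difficulty: provable-now] -/
@[route_item "route-CriticalPhenomena-PercVarianceSandwich"]
def TargetOfCruxes : Prop :=
  CritBlockingNotSuperpolynomial → FiniteClusterMomentsOfTheta → Target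

-- `TargetOfCruxes` holds: proved by `Summit.CriticalPhenomena.PercolationContinuityZ3.Theorems.PercVarianceSandwichTargetOfCruxes.targetOfCruxes_proof` @ 5aefe60a5ebd (its module imports this route file, so no `_holds` link can be stated here).

/-- item stmt-CriticalPhenomena-6068 · support · rank 9 · closed · proved by Summit.CriticalPhenomena.PercolationContinuityZ3.Theorems.VarianceSandwichMomentSandwich.momentSandwich_proof @ 35e912aea221 (prover) · by planner
sources: EfronStein1981, Steele1986, BoucheronEtAl2005, Grimmett1999, AizenmanKestenNewman1987
[support] THE GLUE (moment sandwich, all k ≥ 1, same p, no sprinkling): if θ(p) > 0 and the 2k-th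
truncated moment Σ_(x : Fin 2k → Site 3) P_p(⋂_i {0 ↔ x_i} minus {0 ↔ ∞}) is finite, then there is K
with P_p(no vertex of box 3 n lies in an infinite cluster) ≤ K / n^(3k) for all n ≥ 1. Proof sketch
(elementary, provable now; size L): (i) local approximation Z^(m) := #{x ∈ B(n) : x ↔
innerBoundary(B(m)) inside B(m)} ↓ Z_n := #{x ∈ B(n) : x ↔ ∞} as m → ∞, 0 ≤ Z^(m) ≤ |B(n)|; (ii)
finitary Efron–Stein for the function Z^(m) of the edges of B(m): Var f ≤ Σ_e p(1−p) E[(Δ_e f)²];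
applied to g = (Z − EZ)₋^j with |Δ_e g| ≤ j (Z−EZ)₋(ω^(e closed))^(j−1) Δ_e Z (Z is increasing, u ↦
u₋ is 1-Lipschitz) it gives Var g ≤ j² E[(Z−EZ)₋^(2j−2) V⁻], V⁻ := p Σ_(e closed) (Δ_e Z)²; with (E
g)² ≤ m_(2j−2) m_2 and Hölder, m_(2j) := E(Z−EZ)₋^(2j) satisfies m_(2j) ≤ j² m_(2j)^(1−1/j)
(E(V⁻)^j)^(1/j) + m_(2j−2) m_2, whence by induction m_(2k) ≤ c_k E[(V⁻)^k] with c_1 = 1, c_k ≤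
max((2k²)^k, 2c_(k−1)); (iii) deterministic contact bound: opening a closed edge e = uv of B(m)
changes Z^(m) only if exactly one endpoint, say v, is joined to ∂B(m); then the B(m)-cluster F of u
avoids innerBoundary(B(m)), hence is -/
@[route_item "route-CriticalPhenomena-PercVarianceSandwich"]
def MomentSandwich : Prop :=
  ∀ (p : unitInterval) (k : ℕ), 1 ≤ k → 0 < Literature.Probability.Percolation.theta (Literature.Probability.LatticeModels.zdGraph 3) 0 p → (Summable fun x : Fin (2 * k) → Literature.Probability.LatticeModels.Site 3 => (Literature.Probability.Percolation.bondPercolation (Literature.Probability.LatticeModels.zdGraph 3) p).real ((⋂ i, Literature.Probability.Percolation.openConn 0 (x i)) \ Literature.Probability.Percolation.percolatesAt 0)) → ∃ K : ℝ, ∀ n : ℕ, 1 ≤ n → (Literature.Probability.Percolation.bondPercolation (Literature.Probability.LatticeModels.zdGraph 3) p).real {ω | ∀ x ∈ Literature.Probability.LatticeModels.box 3 n, ω ∉ Literature.Probability.Percolation.percolatesAt x} ≤ K / (n : ℝ) ^ (3 * k)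

-- `MomentSandwich` holds: proved by `Summit.CriticalPhenomena.PercolationContinuityZ3.Theorems.VarianceSandwichMomentSandwich.momentSandwich_proof` @ 35e912aea221 (its module imports this route file, so no `_holds` link can be stated here).

/-- item stmt-CriticalPhenomena-6069 · support · rank 9 · closed · proved by Summit.CriticalPhenomena.PercolationContinuityZ3.Theorems.VarianceSandwich.varianceSandwich_proof @ e0c87946ffb7 (prover) · by planner
sources: EfronStein1981, Steele1986, Grimmett1999, AizenmanKestenNewman1987
[support] The card's original k = 1 sandwich with explicit constant, valid at EVERY p (trivial when
θ(p) = 0): if the pair truncated connectivity is summable then θ(p)² (2n+1)³ P_p(no vertex of box 3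
n is in an infinite cluster) ≤ 6p · Σ_(x,y) P_p(0 ↔ x, 0 ↔ y, |C(0)| < ∞) (= 6p E_p[|C|²; fin]).
Proof: steps (i), (iii) of MomentSandwich with plain Efron–Stein (Var Z^(m) ≤ E[V⁻] ≤ 6p |B(n)|
E[|C|²;fin]) and Chebyshev P(Z_n = 0) ≤ Var Z_n / (E Z_n)², E Z_n = θ(p)|B(n)|. The natural first
target for a prover (size M); it pairs with the k = 3-type special case of A (limsup n³ s_n = ∞).
[difficulty: M] -/
@[route_item "route-CriticalPhenomena-PercVarianceSandwich"]
def VarianceSandwich : Prop :=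
  ∀ (p : unitInterval) (n : ℕ), (Summable fun xy : Literature.Probability.LatticeModels.Site 3 × Literature.Probability.LatticeModels.Site 3 => (Literature.Probability.Percolation.bondPercolation (Literature.Probability.LatticeModels.zdGraph 3) p).real ((Literature.Probability.Percolation.openConn 0 xy.1 ∩ Literature.Probability.Percolation.openConn 0 xy.2) \ Literature.Probability.Percolation.percolatesAt 0)) → Literature.Probability.Percolation.theta (Literature.Probability.LatticeModels.zdGraph 3) 0 p ^ 2 * ((2 * n + 1 : ℕ) : ℝ) ^ 3 * (Literature.Probability.Percolation.bondPercolation (Literature.Probability.LatticeModels.zdGraph 3) p).real {ω | ∀ x ∈ Literature.Probability.LatticeModels.box 3 n, ω ∉ Literature.Probability.Percolation.percolatesAt x} ≤ 6 * (p : ℝ) * ∑' xy : Literature.Probability.LatticeModels.Site 3 × Literature.Probability.LatticeModels.Site 3, (Literature.Probability.Percolation.bondPercolation (Literature.Probability.LatticeModels.zdGraph 3) p).real ((Literature.Probability.Percolation.openConn 0 xy.1 ∩ Literature.Probability.Percolation.openConn 0 xy.2) \ Literature.Probability.Percolation.percolatesAt 0)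

-- `VarianceSandwich` holds: proved by `Summit.CriticalPhenomena.PercolationContinuityZ3.Theorems.VarianceSandwich.varianceSandwich_proof` @ e0c87946ffb7 (its module imports this route file, so no `_holds` link can be stated here).

/-- item stmt-CriticalPhenomena-6070 · support · rank 9 · closed · proved by Summit.CriticalPhenomena.PercolationContinuityZ3.Theorems.PercVarianceSandwichBlockingLeAvoidance.blockingLeAvoidance_proof @ d224704e6d3c (prover) · by planner
sources: Grimmett1999, Literature.Probability.Percolation.Grimmett1999_prob_exists_percolatesAt
[support] Deterministic inclusion + monotonicity of measure, for n ≤ N and every p: P_p(no open path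
inside box 3 N from box 3 n to innerBoundary(box 3 N)) ≤ P_p(no vertex of box 3 n percolates).
Proof: if x ∈ box n ⊆ box N has an infinite open cluster then (a.s. the open edges are lattice
edges) an infinite self-avoiding open path from x leaves the finite box N; its last vertex before
leaving lies in innerBoundary(box N) and the initial segment stays inside box N. Needs the a.s.
statement ω ⊆ E(ℤ³) under bondPercolation (setBer on the edge set) or the library's path-exit lemma
(cf. Literature.Probability.Percolation.HarrisTheorem exists_openConnIn_exit). [difficulty:
provable-now] -/
@[route_item "route-CriticalPhenomena-PercVarianceSandwich"]
def BlockingLeAvoidance : Prop :=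
  ∀ (p : unitInterval) (n N : ℕ), n ≤ N → (Literature.Probability.Percolation.bondPercolation (Literature.Probability.LatticeModels.zdGraph 3) p).real {ω | ¬ ∃ x ∈ Literature.Probability.LatticeModels.box 3 n, ∃ y ∈ Literature.Probability.LatticeModels.innerBoundary (Literature.Probability.LatticeModels.zdGraph 3) (Literature.Probability.LatticeModels.box 3 N), ω ∈ Literature.Probability.Percolation.openConnIn ↑(Literature.Probability.LatticeModels.box 3 N) x y} ≤ (Literature.Probability.Percolation.bondPercolation (Literature.Probability.LatticeModels.zdGraph 3) p).real {ω | ∀ x ∈ Literature.Probability.LatticeModels.box 3 n, ω ∉ Literature.Probability.Percolation.percolatesAt x}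

-- `BlockingLeAvoidance` holds: proved by `Summit.CriticalPhenomena.PercolationContinuityZ3.Theorems.PercVarianceSandwichBlockingLeAvoidance.blockingLeAvoidance_proof` @ d224704e6d3c (its module imports this route file, so no `_holds` link can be stated here).

/-- item stmt-CriticalPhenomena-6071 · support · rank 9 · closed · proved by Summit.CriticalPhenomena.PercolationContinuityZ3.Theorems.PinholeBlocking.pinholeToPolynomialBlocking_proof @ c31bd914b15a (prover) · by planner
sources: Grimmett1999, NewmanTassionWu2017
[support] CritPinholeBlocking → CritBlockingNotSuperpolynomial (finite energy + union bound,
provable now): on the pinhole event choose S(ω) ⊆ edgesIn(box 3 (2n)) with |S| ≤ k (edges outside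
the box are irrelevant to paths inside it; ≤ (C n³)^k choices); for a fixed finite S and the
decreasing blocking event E, P_p(ω minus S ∈ E) = P_p(E ∩ {S closed}) / (1−p)^|S| ≤ P_p(E) /
(1−p)^|S| by independence of the edges of S from E∘(ω ↦ ω minus S); hence c ≤ (C n³)^k (1−p_c)^(−k)
s_n, i.e. s_n ≥ c' n^(−3k) for all n ≥ 1, and A holds with exponent 3k+1 (uses 0 < p_c < 1,
Literature fact Grimmett1999_criticalProb_pos_lt_one / proved bounds for ℤ³). [difficulty:
provable-now] -/
@[route_item "route-CriticalPhenomena-PercVarianceSandwich"]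
def PinholeToPolynomialBlocking : Prop :=
  (∃ (k : ℕ) (c : ℝ), 0 < c ∧ ∀ n : ℕ, 1 ≤ n → c ≤ (Literature.Probability.Percolation.bondPercolation (Literature.Probability.LatticeModels.zdGraph 3) (Literature.Probability.Percolation.criticalProbI 3)).real {ω | ∃ S : Finset (Sym2 (Literature.Probability.LatticeModels.Site 3)), S.card ≤ k ∧ ¬ ∃ x ∈ Literature.Probability.LatticeModels.box 3 n, ∃ y ∈ Literature.Probability.LatticeModels.innerBoundary (Literature.Probability.LatticeModels.zdGraph 3) (Literature.Probability.LatticeModels.box 3 (2 * n)), ω \ ↑S ∈ Literature.Probability.Percolation.openConnIn ↑(Literature.Probability.LatticeModels.box 3 (2 * n)) x y}) → ∃ k : ℕ, ∀ K : ℝ, ∃ n : ℕ, 1 ≤ n ∧ K / (n : ℝ) ^ k < (Literature.Probability.Percolation.bondPercolation (Literature.Probability.LatticeModels.zdGraph 3) (Literature.Probability.Percolation.criticalProbI 3)).real {ω | ¬ ∃ x ∈ Literature.Probability.LatticeModels.box 3 n, ∃ y ∈ Literature.Probability.LatticeModels.innerBoundary (Literature.Probability.LatticeModels.zdGraph 3)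 (Literature.Probability.LatticeModels.box 3 (2 * n)), ω ∈ Literature.Probability.Percolation.openConnIn ↑(Literature.Probability.LatticeModels.box 3 (2 * n)) x y}

-- `PinholeToPolynomialBlocking` holds: proved by `Summit.CriticalPhenomena.PercolationContinuityZ3.Theorems.PinholeBlocking.pinholeToPolynomialBlocking_proof` @ c31bd914b15a (its module imports this route file, so no `_holds` link can be stated here).

/-- item stmt-CriticalPhenomena-6072 · assembly · rank 1 · closed · proved by Summit.CriticalPhenomena.PercolationContinuityZ3.Theorems.PercVarianceSandwichAssembly.assembly_proof @ f5fa9107e126 (prover) · by planner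
sources: Grimmett1999, EfronStein1981
[assembly] MomentSandwich → BlockingLeAvoidance → CritBlockingNotSuperpolynomial →
FiniteClusterMomentsOfTheta → PercolationContinuityZ3 (the two supports first, then A, then B;
expanded verbatim below). -/
@[route_item "route-CriticalPhenomena-PercVarianceSandwich"]
def Assembly : Prop :=
  (∀ (p : unitInterval) (k : ℕ), 1 ≤ k → 0 < Literature.Probability.Percolation.theta (Literature.Probability.LatticeModels.zdGraph 3) 0 p → (Summable fun x : Fin (2 * k) → Literature.Probability.LatticeModels.Site 3 => (Literature.Probability.Percolation.bondPercolation (Literature.Probability.LatticeModels.zdGraph 3) p).real ((⋂ i, Literature.Probability.Percolation.openConn 0 (x i)) \ Literature.Probability.Percolation.percolatesAt 0)) → ∃ K : ℝ, ∀ n : ℕ, 1 ≤ n → (Literature.Probability.Percolation.bondPercolation (Literature.Probability.LatticeModels.zdGraph 3) p).real {ω | ∀ x ∈ Literature.Probability.LatticeModels.box 3 n, ω ∉ Literature.Probability.Percolation.percolatesAt x} ≤ K / (n : ℝ) ^ (3 * k)) → (∀ (p : unitInterval) (n N : ℕ), n ≤ N → (Literature.Probability.Percolation.bondPercolation (Literature.Probability.LatticeModels.zdGraph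 3) p).real {ω | ¬ ∃ x ∈ Literature.Probability.LatticeModels.box 3 n, ∃ y ∈ Literature.Probability.LatticeModels.innerBoundary (Literature.Probability.LatticeModels.zdGraph 3) (Literature.Probability.LatticeModels.box 3 N), ω ∈ Literature.Probability.Percolation.openConnIn ↑(Literature.Probability.LatticeModels.box 3 N) x y} ≤ (Literature.Probability.Percolation.bondPercolation (Literature.Probability.LatticeModels.zdGraph 3) p).real {ω | ∀ x ∈ Literature.Probability.LatticeModels.box 3 n, ω ∉ Literature.Probability.Percolation.percolatesAt x}) → (∃ k : ℕ, ∀ K : ℝ, ∃ n : ℕ, 1 ≤ n ∧ K / (n : ℝ) ^ k < (Literature.Probability.Percolation.bondPercolation (Literature.Probability.LatticeModels.zdGraph 3) (Literature.Probability.Percolation.criticalProbI 3)).real {ω | ¬ ∃ x ∈ Literature.Probability.LatticeModels.box 3 n, ∃ y ∈ Literature.Probability.LatticeModels.innerBoundary (Literature.Probability.LatticeModels.zdGraph 3) (Literature.Probability.LatticeModels.box 3 (2 * n)), ω ∈ Literature.Probability.Percolation.openConnIn ↑(Literature.Probability.LatticeModels.box 3 (2 * n)) x y}) → (∀ p : unitInterval,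 0 < Literature.Probability.Percolation.theta (Literature.Probability.LatticeModels.zdGraph 3) 0 p → ∀ k : ℕ, Summable fun x : Fin k → Literature.Probability.LatticeModels.Site 3 => (Literature.Probability.Percolation.bondPercolation (Literature.Probability.LatticeModels.zdGraph 3) p).real ((⋂ i, Literature.Probability.Percolation.openConn 0 (x i)) \ Literature.Probability.Percolation.percolatesAt 0)) → PercolationContinuityZ3

-- `Assembly` holds: proved by `Summit.CriticalPhenomena.PercolationContinuityZ3.Theorems.PercVarianceSandwichAssembly.assembly_proof` @ f5fa9107e126 (its module imports this route file, so no `_holds` link can be stated here).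

/-! D-0027 §2.1 — DECIDING THEOREM (planner-authored via `route open/edit --closes-file`; by planner-rchoice-CriticalPhenomena-PercVariance-821940b9-0 2026-08-16T03:22:57Z):
its hypotheses are this route's items and its conclusion the sub-problem Statement (glue_lint), and it elaborates with this file. -/

/-- D-0027 §2.1 deciding theorem of route PercVarianceSandwich. Pure logic from the cruxes
A (`CritBlockingNotSuperpolynomial`), B (`FiniteClusterMomentsOfTheta`) and the support items
`MomentSandwich`, `BlockingLeAvoidance`: if `θ(p_c) ≠ 0` then `θ(p_c) > 0` (`measureReal_nonneg`);
A gives `k₀`, put `k := max k₀ 1`; B at `p_c` with order `2k` feeds `MomentSandwich`, giving `K` with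
`P_{p_c}(box n misses C_∞) ≤ K / n^(3k)` for `n ≥ 1`; `BlockingLeAvoidance` (`N = 2n`) bounds the
blocking probability `s_n` by the same; A at `K' := max K 0` yields `n ≥ 1` with
`K'/n^k₀ < s_n ≤ K/n^(3k) ≤ K'/n^(3k) ≤ K'/n^k₀` — contradiction; hence `θ(p_c) = 0`, i.e.
`PercolationContinuityZ3` (`percolationContinuityZ3_iff`). The hypotheses `Target`, `CritPinholeBlocking`,
`VarianceSandwich`, `PinholeToPolynomialBlocking`, `Assembly` are listed items the proof does not use
(kept so that the type is exactly the gate's glue target). -/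
@[closes "route-CriticalPhenomena-PercVarianceSandwich"] theorem closes : Target → FiniteClusterMomentsOfTheta → CritBlockingNotSuperpolynomial → CritPinholeBlocking → MomentSandwich → VarianceSandwich → BlockingLeAvoidance → PinholeToPolynomialBlocking → Assembly → _root_.PercolationContinuityZ3 := by
  intro _hT hB hA _hPin hMS _hVS hBA _hP2P _hAsm
  refine Literature.Probability.Percolation.percolationContinuityZ3_iff.mpr ?_
  by_contra hne
  have hpos : 0 < Literature.Probability.Percolation.theta (Literature.Probability.LatticeModels.zdGraph 3) 0
      (Literature.Probability.Percolation.criticalProbI 3) :=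
    lt_of_le_of_ne MeasureTheory.measureReal_nonneg (Ne.symm hne)
  obtain ⟨k₀, hk₀⟩ := hA
  obtain ⟨K, hK⟩ := hMS (Literature.Probability.Percolation.criticalProbI 3) (max k₀ 1) (le_max_right _ _)
    hpos (hB _ hpos (2 * max k₀ 1))
  obtain ⟨n, hn1, hlt⟩ := hk₀ (max K 0)
  have h1 := hBA (Literature.Probability.Percolation.criticalProbI 3) n (2 * n) (by omega)
  have h2 := hK n hn1
  have hn : (1 : ℝ) ≤ (n : ℝ) := by exact_mod_cast hn1
  have hnpos : (0 : ℝ) < (n : ℝ) := by linarith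
  have h3 : K / (n : ℝ) ^ (3 * max k₀ 1) ≤ max K 0 / (n : ℝ) ^ (3 * max k₀ 1) :=
    div_le_div_of_nonneg_right (le_max_left _ _) (by positivity)
  have h4 : max K 0 / (n : ℝ) ^ (3 * max k₀ 1) ≤ max K 0 / (n : ℝ) ^ k₀ := by
    apply div_le_div_of_nonneg_left (le_max_right _ _) (by positivity)
    exact pow_le_pow_right₀ hn (by omega)
  linarith

end Summit.CriticalPhenomena.PercolationContinuityZ3.Theses.PercVarianceSandwich
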